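import Literature.MathematicalPhysics.QuantumLattice.GibbsVariationalPrinciple
import Literature.Combinatorics.Optimization.DensityMatrixApproximation
import Literature.LinearAlgebra.Matrix.HermitianCfcDiagonalForm
import HarnessLib

/-!
# Lee–Raghavendra–Steurer 2015, Lemma 4.2 (a single linear test is nearly minimised at a Gibbs state), PROVED

LRS Lemma 4.2 (arXiv:1411.6317 p. 18) is the first of the two steps of the printed proof of the density
matrix approximation theorem (Thm 4.1 = Thm 3.4, the named fact `LeeRaghavendraSteurer2015_thm34` of
`DensityMatrixApproximation.lean`): "For every symmetric matrix `F` and every density matrix `Q`,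
`Tr(F · e^{−λF}/Tr e^{−λF}) ≤ Tr(FQ) + ε` as long as `λ ≥ (1/ε)·S(Q‖𝕀)`", proved there from "the
duality formula for quantum entropy: `X ↦ λ Tr(FX) + S(X‖𝕀)` is minimized at
`X⋆ = e^{−λF}/Tr e^{−λF}`" and `S(X⋆‖𝕀) ≥ 0`.  This file PROVES it (no facts, no definitions):

* `Lemma42.trace_gibbs_le_complex` — the complex Hermitian form, directly from the tree's Gibbs
  variational principle in density-matrix form (`Matrix.IsHermitian.vonNeumannEntropy_sub_mul_le_log_partitionFn`,
  `Literature/MathematicalPhysics/QuantumLattice/GibbsVariationalPrinciple.lean`) and the entropy bound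
  of the Gibbs state `S(X⋆) ≤ log dim` (`Matrix.IsHermitian.mul_energy_le_log_card_sub_log_partitionFn`):
  `λ Tr(F X⋆) = S(X⋆) − log Z ≤ log dim − log Z ≤ log dim − S(Q) + λ Tr(FQ)`, i.e. the printed
  two-line argument with `S(·‖𝕀) = log dim − S(·)`;
* the transport `ℝ^{r×r} ⊂ ℂ^{r×r}` (`A ↦ A.map ofReal`) needed to state it in the REAL vocabulary of
  `DensityMatrixApproximation.lean`: `Lemma42.isHermitian_map_ofReal`, `posSemidef_map_ofReal`
  (through `Q = (Q^{1/2})²`), `trace_map_ofReal`, **`cfc_map_ofReal`** (the functional calculus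
  commutes with the inclusion, from a real orthogonal diagonalisation and
  `Literature.LinearAlgebra.Matrix.cfc_eq_conj_diagonal`), `vonNeumannEntropy_map_ofReal`
  (`−Tr(Q log Q)` = the eigenvalue entropy of `Q ⊗ ℂ`), `gibbsWeight_map_ofReal`
  (`e^{−λ(F⊗ℂ)} = e^{−λ·}(F) ⊗ ℂ`);
* `LeeRaghavendraSteurer2015_lemma42` — the printed statement for real symmetric `F`, `IsDensityMatrix Q`,
  `relEntropy Q (uniformDensity r)` and every `λ > 0`: `Tr(F · e^{−λF}/Tr e^{−λF}) ≤ Tr(FQ) + S(Q‖𝕀)/λ`.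

What remains for `LeeRaghavendraSteurer2015_thm34` is the second step (Lemma 4.3 / Cor 4.4, p. 18–19:
Taylor truncation of `e^x` with relative error on `[−τ/2, τ/2]` and the eigenvalue-wise comparison of
`e^{F'}/Tr e^{F'}` with `p(F'/2)²/Tr p(F'/2)²`).

Source: [LeeRaghavendraSteurer2015] held text `paper:arxiv-1411.6317`, Lemma 4.2 and its proof (p. 18),
proof of Thm 4.1 (p. 19).
-/

noncomputable section

open Finset Matrix
open scoped ComplexOrder Matrix.Norms.L2Operator

namespace Literature.Combinatorics.Optimization

namespace Lemma42

open Literature.MathematicalPhysics.QuantumLattice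

/-- **LRS Lemma 4.2, complex Hermitian form.**  For a Hermitian `F`, a density matrix `Q` and `λ > 0`,
the Gibbs state `X⋆ = e^{−λF}/Tr e^{−λF}` satisfies
`Tr(F X⋆) ≤ Tr(F Q) + S(Q‖𝕀)/λ`, `S(Q‖𝕀) = log dim − S(Q)` ("by the duality formula for quantum entropy
the function `X ↦ λ Tr(FX) + S(X‖𝕀)` is minimized at `X⋆`"; here from the tree's Gibbs variational
principle `S(ρ) − λ Re tr(ρF) ≤ log Z_λ(F)` and `S(X⋆) ≤ log dim`).
[cite: LeeRaghavendraSteurer2015, Lemma 4.2 (p. 18)] -/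
theorem trace_gibbs_le_complex {n : Type*} [Fintype n] [DecidableEq n] {F : Matrix n n ℂ}
    (hF : F.IsHermitian) {Q : Matrix n n ℂ} (hQ : Q.PosSemidef) (hQ1 : Q.trace = 1) {l : ℝ}
    (hl : 0 < l) :
    (F * ((partitionFn l F)⁻¹ • gibbsWeight l F)).trace.re ≤
      (F * Q).trace.re +
        (Real.log (Fintype.card n) - Literature.InformationTheory.Entropy.vonNeumannEntropy Q) / l := by
  haveI : Nonempty n := by
    by_contra h
    rw [not_nonempty_iff] at h
    simp [Matrix.trace] at hQ1
  have h1 := hF.vonNeumannEntropy_sub_mul_le_log_partitionFn l hQ hQ1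
  have h2 := hF.mul_energy_le_log_card_sub_log_partitionFn l
  have h3 : (F * ((partitionFn l F)⁻¹ • gibbsWeight l F)).trace = gibbsState l F F := by
    rw [trace_mul_comm, trace_gibbsDensity_mul]
  have h4 : (Q * F).trace.re = (F * Q).trace.re := by rw [trace_mul_comm]
  rw [h3]
  rw [h4] at h1
  -- `l · Re⟨F⟩ ≤ log dim − log Z ≤ log dim − S(Q) + l Re tr(FQ)`
  have h6 : ((gibbsState l F F).re - (F * Q).trace.re) * l ≤
      Real.log (Fintype.card n) - Literature.InformationTheory.Entropy.vonNeumannEntropy Q := by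
    linarith
  have h7 := (le_div_iff₀ hl).2 h6
  linarith

/-! ### Real symmetric matrices inside complex Hermitian ones (`A ↦ A.map ofReal`) -/

section Bridge

open scoped MatrixOrder
open Complex (ofRealHom)
open Literature.LinearAlgebra.Matrix (cfc_continuousOn cfc_eq_conj_diagonal)

variable {m : Type*} [Fintype m] [DecidableEq m]

omit [Fintype m] [DecidableEq m] in
/-- A real symmetric matrix is complex Hermitian. [cite: LeeRaghavendraSteurer2015, §2.1 (p. 10: "𝓜(H) consists of symmetric matrices")] -/
theorem isHermitian_map_ofReal {A : Matrix m m ℝ} (hA : A.IsSymm) : (A.map ofRealHom).IsHermitian :=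
  Matrix.IsHermitian.ext fun i j => by
    simp only [map_apply, Complex.ofRealHom_eq_coe, Complex.star_def, Complex.conj_ofReal, hA.apply i j]

omit [Fintype m] [DecidableEq m] in
/-- `star` commutes with the inclusion. [cite: LeeRaghavendraSteurer2015, §2.1 (p. 10)] -/
theorem star_map_ofReal (A : Matrix m m ℝ) : star (A.map ofRealHom) = (star A).map ofRealHom := by
  rw [star_eq_conjTranspose, star_eq_conjTranspose, conjTranspose_map]
  intro a
  simp [Complex.ofRealHom_eq_coe]

omit [DecidableEq m] in
/-- The trace commutes with the inclusion. [cite: LeeRaghavendraSteurer2015, §2.1 (p. 10)] -/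
theorem trace_map_ofReal (A : Matrix m m ℝ) : (A.map ofRealHom).trace = (A.trace : ℂ) := by
  simp [Matrix.trace, Complex.ofRealHom_eq_coe]

omit [Fintype m] [DecidableEq m] in
/-- Real scalars commute with the inclusion. [cite: LeeRaghavendraSteurer2015, §2.1 (p. 10)] -/
theorem map_ofReal_smul (a : ℝ) (A : Matrix m m ℝ) :
    (a • A).map ofRealHom = (a : ℂ) • A.map ofRealHom := by
  ext i j
  simp [Complex.ofRealHom_eq_coe]

omit [Fintype m] [DecidableEq m] in
/-- A real symmetric matrix is Hermitian over `ℝ`. [cite: LeeRaghavendraSteurer2015, §2.1 (p. 10)] -/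
theorem isHermitian_of_isSymm {A : Matrix m m ℝ} (hA : A.IsSymm) : A.IsHermitian := by
  show Aᴴ = A
  rw [conjTranspose_eq_transpose_of_trivial]
  exact hA

/-- **The functional calculus commutes with the inclusion `ℝ^{m×m} ⊂ ℂ^{m×m}`** for symmetric real
matrices: `f(A) ⊗ ℂ = f(A ⊗ ℂ)` (both are `U diag(f(λ)) Uᵀ` for a real orthogonal diagonalisation
`A = U diag(λ) Uᵀ`). [cite: LeeRaghavendraSteurer2015, §2.1 (p. 10: "we define g(X) via its Taylor series")] -/
theorem cfc_map_ofReal {A : Matrix m m ℝ} (hA : A.IsSymm) (f : ℝ → ℝ) :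
    cfc f (A.map ofRealHom) = (cfc f A).map ofRealHom := by
  have hAh : A.IsHermitian := isHermitian_of_isSymm hA
  obtain ⟨U, hU⟩ : ∃ U : Matrix m m ℝ, U = (hAh.eigenvectorUnitary : Matrix m m ℝ) := ⟨_, rfl⟩
  have hUm : U ∈ Matrix.unitaryGroup m ℝ := hU ▸ hAh.eigenvectorUnitary.2
  have hspec : A = U * diagonal (fun k => ((hAh.eigenvalues k : ℝ) : ℝ)) * star U := by
    rw [hU]
    conv_lhs => rw [hAh.spectral_theorem, Unitary.conjStarAlgAut_apply]
    rfl
  have hR : cfc f A = U * diagonal (fun k => ((f (hAh.eigenvalues k) : ℝ) : ℝ)) * star U :=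
    cfc_eq_conj_diagonal hUm hspec f
  have hUU : star U * U = 1 := Matrix.mem_unitaryGroup_iff'.1 hUm
  have hVm : U.map ofRealHom ∈ Matrix.unitaryGroup m ℂ := by
    rw [Matrix.mem_unitaryGroup_iff', star_map_ofReal, ← Matrix.map_mul, hUU,
      Matrix.map_one _ (map_zero _) (map_one _)]
  have hspecC : A.map ofRealHom =
      U.map ofRealHom * diagonal (fun k => ((hAh.eigenvalues k : ℝ) : ℂ)) * star (U.map ofRealHom) := by
    conv_lhs => rw [hspec]
    rw [Matrix.map_mul, Matrix.map_mul, ← star_map_ofReal, diagonal_map (map_zero _)]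
    rfl
  rw [cfc_eq_conj_diagonal hVm hspecC f, hR, Matrix.map_mul, Matrix.map_mul, ← star_map_ofReal,
    diagonal_map (map_zero _)]
  rfl

/-- A real psd matrix is complex psd. [cite: LeeRaghavendraSteurer2015, §2.1 (p. 10: "𝒟(H) consists of symmetric, positive semidefinite matrices")] -/
theorem posSemidef_map_ofReal {Q : Matrix m m ℝ} (hQ : Q.PosSemidef) : (Q.map ofRealHom).PosSemidef := by
  have hQ0 : (0 : Matrix m m ℝ) ≤ Q := Matrix.nonneg_iff_posSemidef.2 hQ
  have hSS : CFC.sqrt Q * CFC.sqrt Q = Q := CFC.sqrt_mul_sqrt_self Q hQ0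
  have hS0 : (0 : Matrix m m ℝ) ≤ CFC.sqrt Q := CFC.sqrt_nonneg Q
  have hSh : (CFC.sqrt Q).IsHermitian := (Matrix.nonneg_iff_posSemidef.1 hS0).1
  have hSsymm : (CFC.sqrt Q).IsSymm := by
    have h := hSh.eq
    rwa [conjTranspose_eq_transpose_of_trivial] at h
  rw [← hSS, Matrix.map_mul]
  have h := Matrix.posSemidef_conjTranspose_mul_self ((CFC.sqrt Q).map ofRealHom)
  rwa [(isHermitian_map_ofReal hSsymm).eq] at h

/-- The von Neumann entropies agree: `S(Q ⊗ ℂ) = −Tr(Q log Q)`. [cite: LeeRaghavendraSteurer2015, §2.1 (p. 10: "S(X) = −Tr(X log X)")] -/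
theorem vonNeumannEntropy_map_ofReal {r : ℕ} {Q : Matrix (Fin r) (Fin r) ℝ} (hQ : Q.IsSymm) :
    Literature.InformationTheory.Entropy.vonNeumannEntropy (Q.map ofRealHom) = vonNeumannEntropy Q := by
  rw [Literature.InformationTheory.Entropy.vonNeumannEntropy_eq_re_trace_cfc_negMulLog
      (isHermitian_map_ofReal hQ), cfc_map_ofReal hQ, trace_map_ofReal, Complex.ofReal_re]
  unfold vonNeumannEntropy
  have hQ' : IsSelfAdjoint Q := isHermitian_of_isSymm hQ
  rw [Real.negMulLog_eq_neg, cfc_neg, cfc_mul (fun x : ℝ => x) Real.log Q (cfc_continuousOn Q _)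
    (cfc_continuousOn Q _), cfc_id' ℝ Q, trace_neg]

/-- The Gibbs weight of the complexified matrix is the complexified real functional calculus:
`e^{−λ(F ⊗ ℂ)} = (e^{−λ·}(F)) ⊗ ℂ`. [cite: LeeRaghavendraSteurer2015, Lemma 4.2 (p. 18: "e^{−λF}/Tr(e^{−λF})")] -/
theorem gibbsWeight_map_ofReal {F : Matrix m m ℝ} (hF : F.IsSymm) (l : ℝ) :
    gibbsWeight l (F.map ofRealHom) = (cfc (fun x => Real.exp (-(l * x))) F).map ofRealHom := by
  have hFsa : IsSelfAdjoint (F.map ofRealHom) := isHermitian_map_ofReal hF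
  have h1 : gibbsWeight l (F.map ofRealHom) =
      cfc (fun x : ℝ => Real.exp (-(l * x))) (F.map ofRealHom) := by
    have hsmul : (-(l : ℂ) • F.map ofRealHom : Matrix m m ℂ) = (-l : ℝ) • F.map ofRealHom := by
      ext i j
      simp [Matrix.smul_apply, Complex.real_smul]
    have hfun : (fun x : ℝ => Real.exp (-(l * x))) = fun x => Real.exp ((-l) • x) := by
      funext x
      simp only [smul_eq_mul, neg_mul]
    have hsa2 : IsSelfAdjoint ((-l) • F.map ofRealHom) :=
      (show IsSelfAdjoint (-l) from star_trivial _).smul hFsa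
    rw [hfun, gibbsWeight, hsmul, cfc_comp_smul (-l) Real.exp (F.map ofRealHom),
      CFC.real_exp_eq_normedSpace_exp]
  rw [h1, cfc_map_ofReal hF]

end Bridge

/-! ### Lemma 4.2 in the vocabulary of `DensityMatrixApproximation.lean` -/

open Complex (ofRealHom) in
/-- **Lee–Raghavendra–Steurer 2015, Lemma 4.2 (PROVED).**  "For every symmetric matrix `F` and every
density matrix `Q`, `Tr(F · e^{−λF}/Tr e^{−λF}) ≤ Tr(FQ) + ε` as long as `λ ≥ (1/ε)·S(Q‖𝕀)`" — stated
as `Tr(F · e^{−λF}/Tr e^{−λF}) ≤ Tr(FQ) + S(Q‖𝕀)/λ` for every `λ > 0`, for real symmetric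
`F ∈ ℝ^{r×r}`, `IsDensityMatrix Q`, `relEntropy`/`uniformDensity` of `DensityMatrixApproximation.lean`
and the matrix function `e^{−λ·}(F) = cfc (x ↦ e^{−λx}) F`.  Proof: the complex Hermitian form
`Lemma42.trace_gibbs_le_complex` transported along `ℝ^{r×r} ⊂ ℂ^{r×r}`.
[cite: LeeRaghavendraSteurer2015, Lemma 4.2 (p. 18)] -/
theorem _root_.Literature.Combinatorics.Optimization.LeeRaghavendraSteurer2015_lemma42 {r : ℕ}
    {F Q : Matrix (Fin r) (Fin r) ℝ} (hF : F.IsSymm) (hQ : IsDensityMatrix Q) {l : ℝ} (hl : 0 < l) :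
    (F * (((cfc (fun x => Real.exp (-(l * x))) F).trace)⁻¹ •
        cfc (fun x => Real.exp (-(l * x))) F)).trace ≤
      (F * Q).trace + relEntropy Q (uniformDensity r) / l := by
  have hr : 0 < r := by
    rcases Nat.eq_zero_or_pos r with h | h
    · exfalso
      subst h
      have := hQ.2
      rw [Matrix.trace_fin_zero] at this
      exact zero_ne_one this
    · exact h
  obtain ⟨W, hW⟩ : ∃ W : Matrix (Fin r) (Fin r) ℝ, W = cfc (fun x => Real.exp (-(l * x))) F :=
    ⟨_, rfl⟩
  rw [← hW]
  have hQsymm : Q.IsSymm := by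
    have h := hQ.1.1.eq
    rwa [conjTranspose_eq_transpose_of_trivial] at h
  have hQ1 : (Q.map ofRealHom).trace = 1 := by rw [trace_map_ofReal, hQ.2, Complex.ofReal_one]
  have hC := trace_gibbs_le_complex (isHermitian_map_ofReal hF) (posSemidef_map_ofReal hQ.1) hQ1 hl
  have hZ : partitionFn l (F.map ofRealHom) = (W.trace : ℂ) := by
    rw [partitionFn, gibbsWeight_map_ofReal hF, ← hW, trace_map_ofReal]
  have hρ : (partitionFn l (F.map ofRealHom))⁻¹ • gibbsWeight l (F.map ofRealHom) =
      ((W.trace)⁻¹ • W).map ofRealHom := by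
    rw [hZ, gibbsWeight_map_ofReal hF, ← hW, map_ofReal_smul, Complex.ofReal_inv]
  have hlhs : (F.map ofRealHom * ((partitionFn l (F.map ofRealHom))⁻¹ •
      gibbsWeight l (F.map ofRealHom))).trace.re = (F * ((W.trace)⁻¹ • W)).trace := by
    rw [hρ, ← Matrix.map_mul, trace_map_ofReal, Complex.ofReal_re]
  have hrhs : (F.map ofRealHom * Q.map ofRealHom).trace.re = (F * Q).trace := by
    rw [← Matrix.map_mul, trace_map_ofReal, Complex.ofReal_re]
  have hS : Real.log (Fintype.card (Fin r)) -
      Literature.InformationTheory.Entropy.vonNeumannEntropy (Q.map ofRealHom) =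
      relEntropy Q (uniformDensity r) := by
    rw [Fintype.card_fin, vonNeumannEntropy_map_ofReal hQsymm, relEntropy_uniformDensity hr hQ.2]
  rw [hlhs, hrhs, hS] at hC
  exact hC

end Lemma42

end Literature.Combinatorics.Optimization

end
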